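import Summits.QuantumFields.GaugeBoot.BaryonVertexN
import Summits.QuantumFields.GaugeBoot.LayerNetObservable
import HarnessLib

/-!
# The `N`-leg baryon star of a periodic lattice: `2n+1` edge-disjoint paths between adjacent sites (gauge-boot, L3 negative supplement; SU(N odd) link reflection at `β < 0`, part 5)

HONEST FRAMING (cell `pub-gaugeboot`, page 1 of every file): the venture produces certified bounds
on lattice expectations at stated coupling, gauge group, dimension and torus size; NOT a mass gap,
NOT a continuum limit, NOT a string tension; NOT Yang–Mills-summit-bearing (barriers
`FixedCouplingUltralocality`, `PerturbativeInvisibility`). This is the test function of the NEGATIVE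
structural result `CubicTorusLinkRPNegativeBetaOdd.lean` (via `FrameLinkRPLayerNet.lean`): link
reflection positivity fails at every `β < 0` for `N`-dimensional representations of determinant one,
`N = 2n+1` odd, whenever `n` transverse directions besides the direction of the star are available.

`BaryonThetaObservable.lean` is the case `n = 1` (`N = 3`, the theta graph). On a periodic lattice
`(A, e)` fix a site `x`, a direction `l` and `n` further directions `μ₀, …, μ_{n-1}`. The **baryon
star** at `x` is the layer network (`LayerNetObservable.lean`) of the `2n+1` lattice paths from `x`
to `x + e_l`: the link `(x, l)` itself and, for each `j`, the two detours around the plaquettes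
`(x; l, μ_j)` and `(x - e_{μ_j}; l, μ_j)` — `6n+1` links (`starLink`, slots
`StarSlot n = Option ((Fin n × Bool) × Fin 3)`), an ODD number. For an `N`-dimensional `ρ` and a
bijection `φ : Fin N ≃ Option (Fin n × Bool)` (so `N = 2n+1`) its value function is the baryon form
(`BaryonVertexN.lean`) of the `N` transporters (`starVal`), and:

* `card_starSlot` / `odd_card_starSlot` — `|StarSlot n| = 6n+1`;
* `isEntryExpansion_starVal` — the entry expansion (`Baryon.baryonForm_legMat_eq_sum`);
* **`isGaugeInvariant_starVal`** — gauge invariance for `det ρ(g_z) = 1` (every transporter goes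
  `x → x + e_l`; `Baryon.baryonForm_conj`); `starVal_one` (`= N!`, non-zero);
* `starLink_snd_ne`, `map_starLink_fst` (directions and heights), `starLink_sub` (lowering the base);
* **`starLink_injective`** — the `6n+1` links are distinct under explicit non-degeneracy conditions
  on `e_l, e_{μ_j}` (met on the even cubic torus `(ℤ/2Q)^d`, `Q ≥ 2`, for distinct axes).

Everything is `[folklore]` bookkeeping (strong-coupling baryon diagrams: M. Creutz, Quarks, Gluons
and Lattices (1983) Ch. 8; transfer-matrix form: K. Osterwalder, E. Seiler, Ann. Phys. 110 (1978)
440, §2).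
-/

noncomputable section

open MeasureTheory Complex
open scoped Matrix ComplexConjugate

namespace Summit.QuantumFields.GaugeBoot

namespace Baryon

open TiltedRP TwistedSlab LayerNet Equiv

variable {A : Type*} [AddCommGroup A] {d n : ℕ}

/-! ## The star: slots, links, orientations -/

/-- The slots of the `n`-star: the direct link (`none`) and, for each transverse direction `j` and
side `b` (`false` = `+e_{μ_j}`, `true` = `-e_{μ_j}`), the three links of the detour. [folklore] -/
abbrev StarSlot (n : ℕ) : Type := Option ((Fin n × Bool) × Fin 3)

/-- `|StarSlot n| = 6n + 1`. [folklore] -/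
theorem card_starSlot (n : ℕ) : Fintype.card (StarSlot n) = 6 * n + 1 := by
  simp only [StarSlot, Fintype.card_option, Fintype.card_prod, Fintype.card_fin, Fintype.card_bool]
  ring

/-- The number of links of the star is odd. [folklore] -/
theorem odd_card_starSlot (n : ℕ) : Odd (Fintype.card (StarSlot n)) :=
  ⟨3 * n, by rw [card_starSlot]; ring⟩

/-- **The links of the baryon star at `x`** (along `l`, across `μ_j`): `(x, l)`; for side `+`:
`(x, μ_j), (x + e_{μ_j}, l), (x + e_l, μ_j)` (the last traversed backwards); for side `-`:
`(x - e_{μ_j}, μ_j)` (backwards), `(x - e_{μ_j}, l), (x - e_{μ_j} + e_l, μ_j)`. [folklore] -/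
def starLink (e : Fin d → A) (x : A) (l : Fin d) (μ : Fin n → Fin d) : StarSlot n → Link A d
  | none => (x, l)
  | some ((j, false), s) => ![(x, μ j), (x + e (μ j), l), (x + e l, μ j)] s
  | some ((j, true), s) => ![(x - e (μ j), μ j), (x - e (μ j), l), (x - e (μ j) + e l, μ j)] s

/-- The orientation flags of the star links (`true` = traversed backwards). [folklore] -/
def starInv : StarSlot n → Bool
  | none => false
  | some ((_, false), s) => ![false, false, true] s
  | some ((_, true), s) => ![true, false, false] s

/-- The transporter of each leg as a group element: `v`, or `v₀ v₁ v₂⁻¹` (side `+`), or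
`v₀⁻¹ v₁ v₂` (side `-`). [folklore] -/
def starLeg {G : Type*} [Group G] (v : StarSlot n → G) : Option (Fin n × Bool) → G
  | none => v none
  | some (j, false) => v (some ((j, false), 0)) * v (some ((j, false), 1)) * (v (some ((j, false), 2)))⁻¹
  | some (j, true) => (v (some ((j, true), 0)))⁻¹ * v (some ((j, true), 1)) * v (some ((j, true), 2))

/-! ## Geometry of the star links -/

omit [AddCommGroup A] in
/-- The directions of the star links are `l` or some `μ_j`; in particular `≠ k` when `l, μ_j ≠ k`.
[folklore] -/
theorem starLink_snd_ne [AddCommGroup A] (e : Fin d → A) (x : A) {l k : Fin d} {μ : Fin n → Fin d}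
    (hl : l ≠ k) (hμ : ∀ j, μ j ≠ k) (s : StarSlot n) : (starLink e x l μ s).2 ≠ k := by
  rcases s with _ | ⟨⟨j, _ | _⟩, p⟩
  · simpa [starLink]
  · fin_cases p <;> simp [starLink, hl, hμ j]
  · fin_cases p <;> simp [starLink, hl, hμ j]

/-- **Heights of the star links**: an additive map killing `e_l` and the `e_{μ_j}` takes the same
value on every base point of the star as on `x`. [folklore] -/
theorem map_starLink_fst {B : Type*} [AddCommGroup B] (h : A →+ B) (e : Fin d → A) (x : A)
    {l : Fin d} {μ : Fin n → Fin d} (hl : h (e l) = 0) (hμ : ∀ j, h (e (μ j)) = 0) (s : StarSlot n) :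
    h (starLink e x l μ s).1 = h x := by
  rcases s with _ | ⟨⟨j, _ | _⟩, p⟩
  · simp [starLink]
  · fin_cases p <;> simp [starLink, map_add, hl, hμ j]
  · fin_cases p <;> simp [starLink, map_add, map_sub, hl, hμ j]

/-- Lowering the base site by `v` lowers every star link by `v`. [folklore] -/
theorem starLink_sub (e : Fin d → A) (x v : A) (l : Fin d) (μ : Fin n → Fin d) (s : StarSlot n) :
    starLink e (x - v) l μ s = ((starLink e x l μ s).1 - v, (starLink e x l μ s).2) := by
  rcases s with _ | ⟨⟨j, _ | _⟩, p⟩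
  · simp [starLink]
  · fin_cases p <;> simp [starLink] <;> abel
  · fin_cases p <;> simp [starLink] <;> abel

/-- A detour link is never the direct link (`μ_j ≠ l`, `e_{μ_j} ≠ 0`). [folklore] -/
theorem starLink_some_ne_none (e : Fin d → A) (x : A) {l : Fin d} {μ : Fin n → Fin d}
    (hμl : ∀ j, μ j ≠ l) (hμ0 : ∀ j, e (μ j) ≠ 0) (j : Fin n) (b : Bool) (p : Fin 3) :
    starLink e x l μ (some ((j, b), p)) ≠ starLink e x l μ none := by
  intro h
  cases b <;> fin_cases p <;> simp [starLink, hμl, hμ0, sub_eq_add_neg] at h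

/-- A `+`-side link is never a `-`-side link. [folklore] -/
theorem starLink_false_ne_true (e : Fin d → A) (x : A) {l : Fin d} {μ : Fin n → Fin d}
    (hμ : Function.Injective μ) (hμl : ∀ j, μ j ≠ l) (hμ0 : ∀ j, e (μ j) ≠ 0)
    (hne : ∀ j, e l ≠ e (μ j)) (hsum : ∀ j, e l + e (μ j) ≠ 0) (h2 : ∀ j j', e (μ j) + e (μ j') ≠ 0)
    (j j' : Fin n) (p p' : Fin 3) :
    starLink e x l μ (some ((j, false), p)) ≠ starLink e x l μ (some ((j', true), p')) := by
  have hlμ : ∀ j, l ≠ μ j := fun j h => hμl j h.symm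
  have hneg : ∀ j j', e (μ j) ≠ -e (μ j') := fun j j' h => h2 j j' (by rw [h, neg_add_cancel])
  have hlneg : ∀ j, e l ≠ -e (μ j) := fun j h => hsum j (by rw [h, neg_add_cancel])
  have hml : ∀ j, -e (μ j) + e l ≠ 0 := fun j h => (hne j) (neg_add_eq_zero.1 h).symm
  intro h
  fin_cases p <;> fin_cases p' <;>
    simp [starLink, hμl, hlμ, hμ0, hμ.eq_iff, hneg, hlneg, hml, sub_eq_add_neg, add_assoc] at h

/-- The `+`-side links are distinct. [folklore] -/
theorem starLink_false_inj (e : Fin d → A) (x : A) {l : Fin d} {μ : Fin n → Fin d}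
    (hμ : Function.Injective μ) (hμl : ∀ j, μ j ≠ l) (heμ : Function.Injective fun j => e (μ j))
    (hl0 : e l ≠ 0) (hμ0 : ∀ j, e (μ j) ≠ 0) {j j' : Fin n} {p p' : Fin 3}
    (h : starLink e x l μ (some ((j, false), p)) = starLink e x l μ (some ((j', false), p'))) :
    j = j' ∧ p = p' := by
  have hlμ : ∀ j, l ≠ μ j := fun j h => hμl j h.symm
  fin_cases p <;> fin_cases p' <;>
    simp [starLink, hμl, hlμ, hμ0, hl0, hμ.eq_iff, heμ.eq_iff] at h ⊢ <;> exact h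

/-- The `-`-side links are distinct. [folklore] -/
theorem starLink_true_inj (e : Fin d → A) (x : A) {l : Fin d} {μ : Fin n → Fin d}
    (hμ : Function.Injective μ) (hμl : ∀ j, μ j ≠ l) (heμ : Function.Injective fun j => e (μ j))
    (hl0 : e l ≠ 0) {j j' : Fin n} {p p' : Fin 3}
    (h : starLink e x l μ (some ((j, true), p)) = starLink e x l μ (some ((j', true), p'))) :
    j = j' ∧ p = p' := by
  have hlμ : ∀ j, l ≠ μ j := fun j h => hμl j h.symm
  fin_cases p <;> fin_cases p' <;>
    simp [starLink, hμl, hlμ, hμ.eq_iff, heμ.eq_iff, sub_eq_add_neg, add_assoc] at h ⊢ <;>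
    first
      | exact h
      | (obtain ⟨h1, rfl⟩ := h; simp [hl0] at h1)

/-- **The `6n+1` star links are distinct** under the non-degeneracy conditions: `μ` injective with
values `≠ l`, `e ∘ μ` injective, `e_l ≠ 0`, `e_{μ_j} ≠ 0`, `e_l ≠ e_{μ_j}`, `e_l + e_{μ_j} ≠ 0`,
`e_{μ_j} + e_{μ_j'} ≠ 0` (any periodic lattice; all met on the even cubic torus). [folklore] -/
theorem starLink_injective (e : Fin d → A) (x : A) {l : Fin d} {μ : Fin n → Fin d}
    (hμ : Function.Injective μ) (hμl : ∀ j, μ j ≠ l) (heμ : Function.Injective fun j => e (μ j))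
    (hl0 : e l ≠ 0) (hμ0 : ∀ j, e (μ j) ≠ 0) (hne : ∀ j, e l ≠ e (μ j))
    (hsum : ∀ j, e l + e (μ j) ≠ 0) (h2 : ∀ j j', e (μ j) + e (μ j') ≠ 0) :
    Function.Injective (starLink e x l μ) := by
  intro s s' hss'
  rcases s with _ | ⟨⟨j, _ | _⟩, p⟩ <;> rcases s' with _ | ⟨⟨j', _ | _⟩, p'⟩
  · rfl
  · exact absurd hss'.symm (starLink_some_ne_none e x hμl hμ0 j' false p')
  · exact absurd hss'.symm (starLink_some_ne_none e x hμl hμ0 j' true p')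
  · exact absurd hss' (starLink_some_ne_none e x hμl hμ0 j false p)
  · obtain ⟨rfl, rfl⟩ := starLink_false_inj e x hμ hμl heμ hl0 hμ0 hss'; rfl
  · exact absurd hss' (starLink_false_ne_true e x hμ hμl hμ0 hne hsum h2 j j' p p')
  · exact absurd hss' (starLink_some_ne_none e x hμl hμ0 j true p)
  · exact absurd hss'.symm (starLink_false_ne_true e x hμ hμl hμ0 hne hsum h2 j' j p' p)
  · obtain ⟨rfl, rfl⟩ := starLink_true_inj e x hμ hμl heμ hl0 hss'; rfl

/-! ## The value function -/

variable {G : Type*} [Group G] {N : ℕ} (ρ : G →* Matrix (Fin N) (Fin N) ℂ)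

/-- **The value function of the baryon star**: the baryon form of the `N` leg transporters, the legs
`Option (Fin n × Bool)` being identified with the `ε`-indices `Fin N` by `φ`. [folklore] -/
def starVal (φ : Fin N ≃ Option (Fin n × Bool)) (v : StarSlot n → G) : ℂ :=
  baryonForm fun a => legMat (fun s => repOr ρ (starInv s) (v s)) (φ a)

/-- The leg matrices are the images of the leg transporters. [folklore] -/
theorem legMat_repOr_eq (v : StarSlot n → G) (lam : Option (Fin n × Bool)) :
    legMat (fun s => repOr ρ (starInv s) (v s)) lam = ρ (starLeg v lam) := by
  rcases lam with _ | ⟨j, _ | _⟩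
  · simp [legMat, starLeg, starInv]
  · simp [legMat, starLeg, starInv, map_mul]
  · simp [legMat, starLeg, starInv, map_mul]

/-- `starVal` as the baryon form of the images of the leg transporters. [folklore] -/
theorem starVal_eq (φ : Fin N ≃ Option (Fin n × Bool)) (v : StarSlot n → G) :
    starVal ρ φ v = baryonForm fun a => ρ (starLeg v (φ a)) := by
  unfold starVal
  simp only [legMat_repOr_eq]

/-- **The entry expansion of the star** (`Baryon.baryonForm_legMat_eq_sum`). [folklore] -/
theorem isEntryExpansion_starVal (φ : Fin N ≃ Option (Fin n × Bool)) :
    IsEntryExpansion ρ starInv (starVal (G := G) ρ φ) (starCoef (R := ℂ) (Λ := Fin n × Bool))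
      (fun s ι => starRow φ ι s) (fun s ι => starCol φ ι s) :=
  fun v => baryonForm_legMat_eq_sum φ fun s => repOr ρ (starInv s) (v s)

/-- **`starVal(1) = N!`**: the star does not vanish identically. [folklore] -/
theorem starVal_one (φ : Fin N ≃ Option (Fin n × Bool)) :
    starVal ρ φ (fun _ : StarSlot n => (1 : G)) = (N.factorial : ℂ) := by
  rw [starVal_eq]
  have h : ∀ lam : Option (Fin n × Bool), starLeg (fun _ : StarSlot n => (1 : G)) lam = 1 := by
    intro lam
    rcases lam with _ | ⟨j, _ | _⟩ <;> simp [starLeg]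
  simp only [h, map_one]
  exact baryonForm_one

/-- `starVal(1) ≠ 0`. [folklore] -/
theorem starVal_one_ne_zero (φ : Fin N ≃ Option (Fin n × Bool)) :
    starVal ρ φ (fun _ : StarSlot n => (1 : G)) ≠ 0 := by
  rw [starVal_one]
  exact_mod_cast Nat.factorial_ne_zero N

/-! ## Gauge invariance -/

/-- **Every leg of the star goes from `x` to `x + e_l`**: under a gauge transformation
`v_s ↦ g_{x_s} v_s g_{x_s + e_{n_s}}⁻¹` of the star links each leg transporter is conjugated to
`g_x · leg · g_{x + e_l}⁻¹`. [folklore] -/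
theorem starLeg_gauge (e : Fin d → A) (x : A) (l : Fin d) (μ : Fin n → Fin d) (g : A → G)
    (v : StarSlot n → G) (lam : Option (Fin n × Bool)) :
    starLeg (fun s => g (starLink e x l μ s).1 * v s *
        (g ((starLink e x l μ s).1 + e (starLink e x l μ s).2))⁻¹) lam =
      g x * starLeg v lam * (g (x + e l))⁻¹ := by
  rcases lam with _ | ⟨j, _ | _⟩
  · simp [starLeg, starLink]
  · have e1 : x + e (μ j) + e l = x + e l + e (μ j) := add_right_comm _ _ _
    simp only [starLeg, starLink, Matrix.cons_val_zero, Matrix.cons_val_one, Matrix.cons_val, e1,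
      mul_inv_rev, inv_inv]
    group
  · have e2 : x - e (μ j) + e (μ j) = x := sub_add_cancel _ _
    have e3 : x - e (μ j) + e l + e (μ j) = x + e l := by abel
    simp only [starLeg, starLink, Matrix.cons_val_zero, Matrix.cons_val_one, Matrix.cons_val, e2, e3,
      mul_inv_rev, inv_inv]
    group

/-- **Gauge invariance of the baryon star** (`det ρ(g_z) = 1` for all `z`): `Baryon.baryonForm_conj`
with `g_x` and `g_{x + e_l}⁻¹`. [folklore] -/
theorem isGaugeInvariant_starVal (e : Fin d → A) (x : A) (l : Fin d) (μ : Fin n → Fin d)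
    (φ : Fin N ≃ Option (Fin n × Bool)) :
    IsGaugeInvariant ρ e (starLink e x l μ) (starVal (G := G) ρ φ) := by
  intro g v hdet
  rw [starVal_eq, starVal_eq]
  have hdet' : (ρ (g (x + e l))⁻¹).det = 1 := by
    have h1 : ρ (g (x + e l))⁻¹ * ρ (g (x + e l)) = 1 := by rw [← map_mul, inv_mul_cancel, map_one]
    have h2 := congrArg Matrix.det h1
    rw [Matrix.det_mul, hdet, mul_one, Matrix.det_one] at h2
    exact h2
  simp only [starLeg_gauge, map_mul]
  exact baryonForm_conj _ _ _ (hdet x) hdet'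

/-! ## The observable -/

/-- **The baryon star observable at `x`** (along `l`, across `μ`): the network observable of the
star links with value function `starVal`. [folklore] -/
def starObs (e : Fin d → A) (x : A) (l : Fin d) (μ : Fin n → Fin d)
    (φ : Fin N ≃ Option (Fin n × Bool)) (U : Config A d G) : ℂ :=
  netObs (starLink e x l μ) (starVal ρ φ) U

/-- `starObs` unfolded. [folklore] -/
theorem starObs_eq (e : Fin d → A) (x : A) (l : Fin d) (μ : Fin n → Fin d)
    (φ : Fin N ≃ Option (Fin n × Bool)) (U : Config A d G) :
    starObs ρ e x l μ φ U = netObs (starLink e x l μ) (starVal ρ φ) U := rfl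

/-- The baryon star observable is continuous (continuous `ρ`). [folklore] -/
theorem continuous_starVal [TopologicalSpace G] [IsTopologicalGroup G] (hρ : Continuous ρ)
    (φ : Fin N ≃ Option (Fin n × Bool)) : Continuous (starVal (G := G) ρ φ) :=
  (isEntryExpansion_starVal ρ φ).continuous ρ hρ

end Baryon

end Summit.QuantumFields.GaugeBoot

end
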